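import Summits.Ventures.DiscreteObjects.Hadamard.InvolutionTools

/-!
# Hadamard 668 census, family F12 — an automorphism of order 334 of H(668) has two row orbits and two column orbits of length 334 (kernel)

Framing: lottery ticket; floor = certified bounds/negative ranges.

Cell pub-namedobj (venture DiscreteObjects), target (H), hadamard gen 12.  EVEN orders, top of the table.  Let `(π, κ, d, e)` be a
signed-permutation automorphism of a Hadamard matrix of order `668` whose permutation pair has order `334 = 2 · 167`:
`π^334 = κ^334 = 1`, `(π², κ²) ≠ (1,1)`, `(π^167, κ^167) ≠ (1,1)`.  Then (`hadamard668_order334_fpf`) **`π^167` and `κ^167` are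
fixed-point-free**: every `⟨π⟩`-orbit of rows and every `⟨κ⟩`-orbit of columns has exactly `334` elements (two orbits each,
`hadamard668_order334_free`).  Proof (ours, elementary on the kernel census):
* `σ = (π², κ²)` has order `167`, so by `hadamard668_fixedRows_167` `π²`, `κ²` have no fixed point; hence `⟨π⟩` acts freely with
  exponent `167` on `F_r = Fix(π^167)` and `167 ∣ |F_r|` (`dvd_card_fixed_pow`); the moved points of the involution `π^167` pair up,
  so `|F_r| ∈ {0, 334, 668}`, and likewise `|F_c|`;
* `|F_r| = 668` means `π^167 = 1`, and then `κ^167 = 1` (`signedAut_snd_eq_one_of_fst_eq_one`, `668 ≡ 4 (mod 8)`) — excluded;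
* `|F_r| = 334` (`order334_case334`): a fixed row makes the type `ε = +1` (`signedAut_sq_sign`), i.e. the signs `d' = ∏ d`, `e' = ∏ e`
  of `h = (π, κ, d, e)^167` are constant on `h`-pairs.  If `|F_c| = 0` the trace lemma gives `Σ_{F_r} d' = 0`, the column-pair
  identity at any column leaves `Σ_{moved rows} d'_i H_{ij} H_{π' i, j} = 0`, but this invariant `±1` sum is `≡ 334 (mod 4)`
  (`sum_moved_eq_card_sub_four_mul`) — contradiction.  If `|F_c| = 334` all fixed signs equal one `δ` (`signedAut_fixed_sign`);
  the row-pair identity at a moved row `i` reads `334 δ + Σ_{moved j} (±1) = 0`, forcing every term: `H_{i, κ' j} = −δ e'_j H_{ij}`;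
  then row `π' i = δ d'_i (𝟙_{F_c} − 𝟙_{moved}) ⊙ row i`, and orthogonality of the rows `i, π' i` against a third moved row `k`
  gives `Σ_{j ∈ F_c} H_{ij} H_{kj} = 0`: three moved rows from distinct pairs are pairwise orthogonal `±1` vectors on the `334`
  fixed columns, so `4 ∣ 334` (`card_eq_four_mul_of_three_orth`) — contradiction.
So an automorphism of order `334` acts on rows and columns with two regular `Z₃₃₄`-orbits: H(668) would be a `2 × 2` array of
(signed-)circulant blocks of order `334`; the companion file `Order334Nega` shows the signing is necessarily NEGA-cyclic.
Ours, not literature; no `sorry`.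
-/

namespace Summit.Ventures.DiscreteObjects.Hadamard

open Finset BigOperators Matrix

open Literature.Combinatorics.Designs.GoethalsSeidel (IsHadamardMatrix)

variable {ι : Type*} [Fintype ι] [DecidableEq ι]

section perm

/-- **`p ∣ #Fix(σ^p)` when `σ` fixes none of these points** (`p` prime): `⟨σ⟩` acts freely with exponent `p` on `Fix(σ^p)`. -/
lemma dvd_card_fixed_pow (σ : Equiv.Perm ι) {p : ℕ} (hp : p.Prime) (hno : ∀ i, (σ ^ p) i = i → σ i ≠ i) :
    p ∣ (univ.filter fun i => (σ ^ p) i = i).card := by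
  have hS : ∀ i, (σ ^ p) (σ i) = σ i ↔ (σ ^ p) i = i := by
    intro i
    rw [pow_apply_comm σ p i]
    constructor
    · intro h; exact σ.injective h
    · intro h; rw [h]
  set ρ : Equiv.Perm {i // (σ ^ p) i = i} := σ.subtypePerm hS with hρdef
  have hρ : ρ ^ p = 1 := by
    ext x
    simp [hρdef, Equiv.Perm.subtypePerm_pow, x.2]
  have hdvd := dvd_card_of_free ρ hp.pos hρ _ (univ : Finset {i // (σ ^ p) i = i}) le_rfl (fun y _ => Finset.mem_univ _)
    (by
      intro y _ k hk0 hkp hfix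
      have hk : (σ ^ k) y.1 = y.1 := by
        have := congrArg Subtype.val hfix
        simpa [hρdef, Equiv.Perm.subtypePerm_pow] using this
      have hcop : Nat.Coprime k p :=
        Nat.Coprime.symm ((Nat.Prime.coprime_iff_not_dvd hp).mpr (Nat.not_dvd_of_pos_of_lt hk0 hkp))
      exact hno y.1 y.2 (perm_fixed_of_pow_coprime σ hcop hp.one_lt hk y.2))
  rwa [Finset.card_univ, Fintype.card_subtype] at hdvd

omit [Fintype ι] [DecidableEq ι] in
/-- a `±1` sum over `S` equal to `−δ·|S|` forces every term to be `−δ` -/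
lemma all_eq_neg_of_sum (S : Finset ι) (g : ι → ℤ) {δ : ℤ} (hδ : δ = 1 ∨ δ = -1) (hg : ∀ j ∈ S, g j = 1 ∨ g j = -1)
    (hsum : ∑ j ∈ S, g j = -(δ * S.card)) : ∀ j ∈ S, g j = -δ := by
  have hδδ : δ * δ = 1 := pm_mul_self hδ
  have h0 : ∑ j ∈ S, (δ * g j + 1) = 0 := by
    rw [Finset.sum_add_distrib, ← Finset.mul_sum, hsum, Finset.sum_const, nsmul_eq_mul, mul_one]
    calc δ * -(δ * S.card) + S.card = -(δ * δ) * S.card + S.card := by ring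
      _ = 0 := by rw [hδδ]; ring
  have hnn : ∀ j ∈ S, 0 ≤ δ * g j + 1 := by
    intro j hj
    rcases hδ with rfl | rfl <;> rcases hg j hj with h | h <;> rw [h] <;> norm_num
  have hall := (Finset.sum_eq_zero_iff_of_nonneg hnn).mp h0
  intro j hj
  have h := hall j hj
  rcases hδ with rfl | rfl <;> linarith

end perm

section case334
variable {H : Matrix ι ι ℤ} {π' κ' : Equiv.Perm ι} {d' e' : ι → ℤ}

/-- **The case `|Fix(π')| = 334` is impossible** for a signed involution pair `(π', κ', d', e')` of a Hadamard matrix of order `668`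
whose fixed columns number `0` or `334` (see the module docstring for the proof). -/
theorem order334_case334 (hH : IsHadamardMatrix H) (hι : Fintype.card ι = 668) (haut : IsSignedAut H π' κ' d' e')
    (hπinv : ∀ i, π' (π' i) = i) (hκinv : ∀ j, κ' (κ' j) = j)
    (hFr : (univ.filter fun i => π' i = i).card = 334)
    (hFc : (univ.filter fun j => κ' j = j).card = 0 ∨ (univ.filter fun j => κ' j = j).card = 334) : False := by
  have hcard : (Fintype.card ι : ℤ) ≠ 0 := by rw [hι]; norm_num
  have hd := haut.1
  have he := haut.2.1
  have hA := haut.2.2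
  have eR : (univ.filter fun i => π' i ≠ i) = univ.filter (fun i => ¬ π' i = i) := rfl
  have eC : (univ.filter fun j => κ' j ≠ j) = univ.filter (fun j => ¬ κ' j = j) := rfl
  have hMr : (univ.filter fun i => ¬ π' i = i).card = 334 := by
    have h := Finset.card_filter_add_card_filter_not (s := (univ : Finset ι)) (fun i => π' i = i)
    rw [Finset.card_univ, hι] at h
    omega
  -- a fixed row r₀; the type is ε = +1
  obtain ⟨r₀, hr₀⟩ : (univ.filter fun i => π' i = i).Nonempty := by rw [← Finset.card_pos, hFr]; norm_num
  have hr₀' : π' r₀ = r₀ := by simpa using hr₀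
  have heinv : ∀ j, e' (κ' j) = e' j := by
    intro j
    have h := signedAut_sq_sign hH.1 haut hπinv hκinv r₀ j
    rw [hr₀', pm_mul_self (hd r₀), one_mul] at h
    exact (pm_eq_of_mul_eq_one (he j) (he (κ' j)) h).symm
  have hdinv : ∀ i, d' (π' i) = d' i := by
    intro i
    have h := signedAut_sq_sign hH.1 haut hπinv hκinv i r₀
    rw [heinv r₀, pm_mul_self (he r₀), mul_one] at h
    exact (pm_eq_of_mul_eq_one (hd i) (hd (π' i)) h).symm
  rcases hFc with hFc0 | hFc334
  · -- |F_c| = 0: trace lemma + column-pair identity + mod 4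
    have hFce : (univ.filter fun j => κ' j = j) = ∅ := Finset.card_eq_zero.mp hFc0
    have hSr : ∑ i ∈ univ.filter (fun i => π' i = i), d' i = 0 := by
      rw [signedAut_trace hH hcard haut, hFce, Finset.sum_empty]
    obtain ⟨j₀⟩ : Nonempty ι := by
      rw [← Fintype.card_pos_iff, hι]; norm_num
    have hj₀ : κ' j₀ ≠ j₀ := by
      intro h
      have : j₀ ∈ univ.filter (fun j => κ' j = j) := by simp [h]
      rw [hFce] at this
      simp at this
    have hcol := signedAut_colPair hH hcard haut hj₀
    -- split the column-pair identity over fixed and moved rows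
    rw [← Finset.sum_filter_add_sum_filter_not univ (fun i => π' i = i)] at hcol
    have hfix : ∑ i ∈ univ.filter (fun i => π' i = i), d' i * (H i j₀ * H (π' i) j₀) = 0 := by
      rw [← hSr]
      refine Finset.sum_congr rfl fun i hi => ?_
      have hi' : π' i = i := by simpa using hi
      rw [hi', pm_mul_self (hH.1 i j₀), mul_one]
    rw [hfix, zero_add] at hcol
    obtain ⟨m, hm⟩ := sum_moved_eq_card_sub_four_mul π' hπinv (fun i => d' i * (H i j₀ * H (π' i) j₀))
      (fun i _ => by
        rcases hd i with h | h <;> rcases hH.1 i j₀ with h1 | h1 <;> rcases hH.1 (π' i) j₀ with h2 | h2 <;>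
          simp [h, h1, h2])
      (fun i _ => by
        show d' (π' i) * (H (π' i) j₀ * H (π' (π' i)) j₀) = d' i * (H i j₀ * H (π' i) j₀)
        rw [hdinv i, hπinv i]; ring)
    rw [eR, hcol, hMr] at hm
    omega
  · -- |F_c| = 334: all fixed signs equal δ
    have hMc : (univ.filter fun j => ¬ κ' j = j).card = 334 := by
      have h := Finset.card_filter_add_card_filter_not (s := (univ : Finset ι)) (fun j => κ' j = j)
      rw [Finset.card_univ, hι] at h
      omega
    have hδ : d' r₀ = 1 ∨ d' r₀ = -1 := hd r₀
    have heδ : ∀ j, κ' j = j → e' j = d' r₀ := fun j hj => (signedAut_fixed_sign hH.1 haut hr₀' hj).symm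
    -- the row-pair identity at a moved row forces every moved term
    have hterm : ∀ i, π' i ≠ i → ∀ j, κ' j ≠ j → e' j * (H i j * H i (κ' j)) = -d' r₀ := by
      intro i hi
      have hrow := signedAut_rowPair hH haut hi
      rw [← Finset.sum_filter_add_sum_filter_not univ (fun j => κ' j = j)] at hrow
      have hfix : ∑ j ∈ univ.filter (fun j => κ' j = j), e' j * (H i j * H i (κ' j)) = d' r₀ * 334 := by
        have e1 : ∑ j ∈ univ.filter (fun j => κ' j = j), e' j * (H i j * H i (κ' j))
            = ∑ j ∈ univ.filter (fun j => κ' j = j), d' r₀ := by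
          refine Finset.sum_congr rfl fun j hj => ?_
          have hj' : κ' j = j := by simpa using hj
          rw [hj', pm_mul_self (hH.1 i j), mul_one, heδ j hj']
        rw [e1, Finset.sum_const, hFc334, nsmul_eq_mul, mul_comm]
        norm_num
      rw [hfix] at hrow
      have hsum : ∑ j ∈ univ.filter (fun j => κ' j ≠ j), e' j * (H i j * H i (κ' j))
          = -(d' r₀ * ((univ.filter fun j => κ' j ≠ j).card : ℤ)) := by
        rw [eC, hMc]
        push_cast
        linarith
      have hall := all_eq_neg_of_sum (univ.filter fun j => κ' j ≠ j) (fun j => e' j * (H i j * H i (κ' j))) hδ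
        (fun j _ => by
          rcases he j with h | h <;> rcases hH.1 i j with h1 | h1 <;> rcases hH.1 i (κ' j) with h2 | h2 <;>
            simp [h, h1, h2]) hsum
      intro j hj
      exact hall j (by simpa using hj)
    -- row π' i is δ d'_i (𝟙_{F_c} − 𝟙_{moved}) ⊙ row i
    have hrowfix : ∀ i j, κ' j = j → H (π' i) j = d' r₀ * d' i * H i j := by
      intro i j hj
      have h := hA i j
      rw [hj] at h
      rw [h, heδ j hj]
      ring
    have hrowmov : ∀ i, π' i ≠ i → ∀ j, κ' j ≠ j → H (π' i) j = -(d' r₀ * d' i * H i j) := by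
      intro i hi j hj
      have hj2 : κ' (κ' j) ≠ κ' j := by rw [hκinv j]; exact Ne.symm hj
      have ht := hterm i hi (κ' j) hj2
      rw [hκinv j, heinv j] at ht
      have h := hA i (κ' j)
      rw [hκinv j, heinv j] at h
      have hsq := pm_mul_self (hH.1 i j)
      have h3 : e' j * H i (κ' j) = -d' r₀ * H i j := by
        calc e' j * H i (κ' j) = e' j * (H i (κ' j) * H i j) * H i j := by
              rw [mul_assoc, mul_assoc, hsq, mul_one]
          _ = -d' r₀ * H i j := by rw [ht]
      rw [h]
      calc d' i * e' j * H i (κ' j) = d' i * (e' j * H i (κ' j)) := by ring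
        _ = d' i * (-d' r₀ * H i j) := by rw [h3]
        _ = -(d' r₀ * d' i * H i j) := by ring
    -- two moved rows from different pairs are orthogonal on the fixed columns
    have horth : ∀ i k, π' i ≠ i → k ≠ i → k ≠ π' i →
        ∑ j ∈ univ.filter (fun j => κ' j = j), H i j * H k j = 0 := by
      intro i k hi hki hkπ
      have o1 := hadamard_row_orth H hH (Ne.symm hki)      -- Σ_j H i j H k j = 0
      have o2 := hadamard_row_orth H hH (Ne.symm hkπ)      -- Σ_j H (π' i) j H k j = 0
      rw [← Finset.sum_filter_add_sum_filter_not univ (fun j => κ' j = j)] at o1 o2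
      have s1 : ∑ j ∈ univ.filter (fun j => κ' j = j), H (π' i) j * H k j
          = d' r₀ * d' i * ∑ j ∈ univ.filter (fun j => κ' j = j), H i j * H k j := by
        rw [Finset.mul_sum]
        refine Finset.sum_congr rfl fun j hj => ?_
        rw [hrowfix i j (by simpa using hj)]; ring
      have s2 : ∑ j ∈ univ.filter (fun j => ¬ κ' j = j), H (π' i) j * H k j
          = -(d' r₀ * d' i) * ∑ j ∈ univ.filter (fun j => ¬ κ' j = j), H i j * H k j := by
        rw [Finset.mul_sum]
        refine Finset.sum_congr rfl fun j hj => ?_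
        rw [hrowmov i hi j (by simpa using hj)]; ring
      rw [s1, s2] at o2
      have hδd : d' r₀ * d' i = 1 ∨ d' r₀ * d' i = -1 := by
        rcases hδ with h | h <;> rcases hd i with h' | h' <;> simp [h, h']
      rcases hδd with h | h <;> rw [h] at o2 <;> linarith
    -- three moved rows from three different pairs
    obtain ⟨i₁, hi₁⟩ : (univ.filter fun i => ¬ π' i = i).Nonempty := by rw [← Finset.card_pos, hMr]; norm_num
    have hi₁' : π' i₁ ≠ i₁ := by simpa using hi₁
    obtain ⟨i₂, hi₂⟩ : (((univ.filter fun i => ¬ π' i = i).erase i₁).erase (π' i₁)).Nonempty := by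
      rw [← Finset.card_pos]
      have h1 := Finset.pred_card_le_card_erase (s := univ.filter fun i => ¬ π' i = i) (a := i₁)
      have h2 := Finset.pred_card_le_card_erase (s := (univ.filter fun i => ¬ π' i = i).erase i₁) (a := π' i₁)
      omega
    simp only [Finset.mem_erase] at hi₂
    obtain ⟨h2π1, h21, hi₂M⟩ := hi₂
    have hi₂' : π' i₂ ≠ i₂ := by simpa using hi₂M
    obtain ⟨i₃, hi₃⟩ :
        (((((univ.filter fun i => ¬ π' i = i).erase i₁).erase (π' i₁)).erase i₂).erase (π' i₂)).Nonempty := by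
      rw [← Finset.card_pos]
      have h1 := Finset.pred_card_le_card_erase (s := univ.filter fun i => ¬ π' i = i) (a := i₁)
      have h2 := Finset.pred_card_le_card_erase (s := (univ.filter fun i => ¬ π' i = i).erase i₁) (a := π' i₁)
      have h3 := Finset.pred_card_le_card_erase
        (s := ((univ.filter fun i => ¬ π' i = i).erase i₁).erase (π' i₁)) (a := i₂)
      have h4 := Finset.pred_card_le_card_erase
        (s := (((univ.filter fun i => ¬ π' i = i).erase i₁).erase (π' i₁)).erase i₂) (a := π' i₂)
      omega
    simp only [Finset.mem_erase] at hi₃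
    obtain ⟨h3π2, h32, h3π1, h31, hi₃M⟩ := hi₃
    have key := card_eq_four_mul_of_three_orth (univ.filter fun j => κ' j = j)
      (fun j => H i₁ j) (fun j => H i₂ j) (fun j => H i₃ j)
      (fun j _ => hH.1 i₁ j) (fun j _ => hH.1 i₂ j) (fun j _ => hH.1 i₃ j)
      (horth i₁ i₂ hi₁' h21 h2π1) (horth i₁ i₃ hi₁' h31 h3π1) (horth i₂ i₃ hi₂' h32 h3π2)
    rw [hFc334] at key
    omega

end case334

section main
variable {H : Matrix ι ι ℤ} {π κ : Equiv.Perm ι} {d e : ι → ℤ}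

/-- the fixed rows of `π^167` number `0`, `334` or `668`, and `668` means `π^167 = 1` -/
lemma order334_card_fixed (hH : IsHadamardMatrix H) (hι : Fintype.card ι = 668) (haut : IsSignedAut H π κ d e)
    (hπ : π ^ 334 = 1) (hκ : κ ^ 334 = 1) (h2 : π ^ 2 ≠ 1 ∨ κ ^ 2 ≠ 1) :
    ((univ.filter fun i => (π ^ 167) i = i).card = 0 ∨ (univ.filter fun i => (π ^ 167) i = i).card = 334 ∨ π ^ 167 = 1) ∧
    (∀ i, (π ^ 2) i ≠ i) ∧ (∀ i, (π ^ 167) ((π ^ 167) i) = i) := by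
  -- σ = g² has order 167: π² is fixed-point-free
  have h167 := hadamard668_fixedRows_167 hH hι (π ^ 2) (κ ^ 2) _ _ (isSignedAut_pow haut 2)
    (by rw [← pow_mul]; exact hπ) (by rw [← pow_mul]; exact hκ) h2
  have hπ2 : ∀ i, (π ^ 2) i ≠ i := by
    intro i hi
    have hmem : i ∈ univ.filter (fun i => (π ^ 2) i = i) := by simp [hi]
    rw [Finset.card_eq_zero.mp h167.1] at hmem
    simp at hmem
  have hinv : ∀ i, (π ^ 167) ((π ^ 167) i) = i := by
    intro i
    rw [← Equiv.Perm.mul_apply, ← pow_add, show 167 + 167 = 334 from rfl, hπ, Equiv.Perm.one_apply]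
  refine ⟨?_, hπ2, hinv⟩
  have hsplit := Finset.card_filter_add_card_filter_not (s := (univ : Finset ι)) (fun i => (π ^ 167) i = i)
  rw [Finset.card_univ, hι] at hsplit
  have h2dvd := two_dvd_card_moved (π ^ 167) hinv
  have e1 : (univ.filter fun i => (π ^ 167) i ≠ i) = univ.filter (fun i => ¬ (π ^ 167) i = i) := rfl
  rw [e1] at h2dvd
  have h167dvd := dvd_card_fixed_pow π (by norm_num : (167 : ℕ).Prime)
    (fun i _ hπi => hπ2 i (by rw [pow_two, Equiv.Perm.mul_apply, hπi, hπi]))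
  obtain ⟨a, ha⟩ := h167dvd
  obtain ⟨b, hb⟩ := h2dvd
  have hcases : (univ.filter fun i => (π ^ 167) i = i).card = 0 ∨ (univ.filter fun i => (π ^ 167) i = i).card = 334 ∨
      (univ.filter fun i => (π ^ 167) i = i).card = 668 := by omega
  rcases hcases with h | h | h
  · exact Or.inl h
  · exact Or.inr (Or.inl h)
  · right; right
    have huniv : (univ.filter fun i => (π ^ 167) i = i) = univ :=
      Finset.eq_univ_of_card _ (by rw [h, hι])
    ext i
    have : i ∈ univ.filter (fun i => (π ^ 167) i = i) := by rw [huniv]; exact Finset.mem_univ i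
    simpa using this

/-- **Order 334, rows: `π^167` is fixed-point-free.**  For a signed automorphism `(π, κ, d, e)` of a Hadamard matrix of order `668`
with `π^334 = κ^334 = 1`, `(π², κ²) ≠ (1, 1)` and `(π^167, κ^167) ≠ (1, 1)`, the involution `π^167` moves every row. -/
theorem hadamard668_order334_rows_fpf (hH : IsHadamardMatrix H) (hι : Fintype.card ι = 668) (haut : IsSignedAut H π κ d e)
    (hπ : π ^ 334 = 1) (hκ : κ ^ 334 = 1) (h2 : π ^ 2 ≠ 1 ∨ κ ^ 2 ≠ 1) (h167 : π ^ 167 ≠ 1 ∨ κ ^ 167 ≠ 1) :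
    ∀ i, (π ^ 167) i ≠ i := by
  have hcard : (Fintype.card ι : ℤ) ≠ 0 := by rw [hι]; norm_num
  have hmod : Fintype.card ι % 8 = 4 := by rw [hι]
  have hne4 : Fintype.card ι ≠ 4 := by rw [hι]; norm_num
  have haut' : IsSignedAut H (π ^ 167) (κ ^ 167) (fun i => cyc π d i 167) (fun j => cyc κ e j 167) := isSignedAut_pow haut 167
  obtain ⟨hr, hπ2, hπinv⟩ := order334_card_fixed hH hι haut hπ hκ h2
  obtain ⟨hc, hκ2, hκinv⟩ := order334_card_fixed (isHadamard_transpose hH hcard) hι (isSignedAut_transpose haut) hκ hπ h2.symm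
  -- neither involution is trivial
  have hπ1 : π ^ 167 ≠ 1 := by
    intro h1
    rw [h1] at haut'
    have := signedAut_snd_eq_one_of_fst_eq_one hH hmod hne4 haut'
    rcases h167 with h | h
    · exact h h1
    · exact h this
  have hκ1 : κ ^ 167 ≠ 1 := by
    intro h1
    rw [h1] at haut'
    exact hπ1 (signedAut_fst_eq_one_of_snd_eq_one hH hmod hne4 haut')
  rcases hr with hr0 | hr334 | hr668
  · intro i hi
    have hmem : i ∈ univ.filter (fun i => (π ^ 167) i = i) := by simp [hi]
    rw [Finset.card_eq_zero.mp hr0] at hmem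
    simp at hmem
  · exfalso
    rcases hc with hc0 | hc334 | hc668
    · exact order334_case334 hH hι haut' hπinv hκinv hr334 (Or.inl hc0)
    · exact order334_case334 hH hι haut' hπinv hκinv hr334 (Or.inr hc334)
    · exact hκ1 hc668
  · exact absurd hr668 hπ1

/-- **Order 334: `π^167` and `κ^167` are both fixed-point-free** (rows by `hadamard668_order334_rows_fpf`, columns by transposition). -/
theorem hadamard668_order334_fpf (hH : IsHadamardMatrix H) (hι : Fintype.card ι = 668) (haut : IsSignedAut H π κ d e)
    (hπ : π ^ 334 = 1) (hκ : κ ^ 334 = 1) (h2 : π ^ 2 ≠ 1 ∨ κ ^ 2 ≠ 1) (h167 : π ^ 167 ≠ 1 ∨ κ ^ 167 ≠ 1) :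
    (∀ i, (π ^ 167) i ≠ i) ∧ (∀ j, (κ ^ 167) j ≠ j) := by
  have hcard : (Fintype.card ι : ℤ) ≠ 0 := by rw [hι]; norm_num
  exact ⟨hadamard668_order334_rows_fpf hH hι haut hπ hκ h2 h167,
    hadamard668_order334_rows_fpf (isHadamard_transpose hH hcard) hι (isSignedAut_transpose haut) hκ hπ h2.symm h167.symm⟩

/-- **Order 334: every row orbit and every column orbit is regular of length 334** — `π^k` and `κ^k` have no fixed point for
`0 < k < 334` (so the rows, and the columns, split into exactly two `⟨g⟩`-orbits of `334`). -/
theorem hadamard668_order334_free (hH : IsHadamardMatrix H) (hι : Fintype.card ι = 668) (haut : IsSignedAut H π κ d e)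
    (hπ : π ^ 334 = 1) (hκ : κ ^ 334 = 1) (h2 : π ^ 2 ≠ 1 ∨ κ ^ 2 ≠ 1) (h167 : π ^ 167 ≠ 1 ∨ κ ^ 167 ≠ 1) :
    (∀ i k, 0 < k → k < 334 → (π ^ k) i ≠ i) ∧ (∀ j k, 0 < k → k < 334 → (κ ^ k) j ≠ j) := by
  have hcard : (Fintype.card ι : ℤ) ≠ 0 := by rw [hι]; norm_num
  obtain ⟨hr, hc⟩ := hadamard668_order334_fpf hH hι haut hπ hκ h2 h167
  obtain ⟨-, hπ2, -⟩ := order334_card_fixed hH hι haut hπ hκ h2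
  obtain ⟨-, hκ2, -⟩ := order334_card_fixed (isHadamard_transpose hH hcard) hι (isSignedAut_transpose haut) hκ hπ h2.symm
  have key : ∀ (σ : Equiv.Perm ι), σ ^ 334 = 1 → (∀ i, (σ ^ 167) i ≠ i) → (∀ i, (σ ^ 2) i ≠ i) →
      ∀ i k, 0 < k → k < 334 → (σ ^ k) i ≠ i := by
    intro σ hσ h167' h2' i k hk0 hk hfix
    by_cases hdvd : 167 ∣ k
    · obtain ⟨t, rfl⟩ := hdvd
      have ht : t = 1 := by omega
      subst ht
      exact h167' i (by simpa using hfix)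
    · -- (σ²)^k i = i and (σ²)^167 i = i with k coprime to 167
      have hcop : Nat.Coprime k 167 := (Nat.Prime.coprime_iff_not_dvd (by norm_num)).mpr hdvd |>.symm
      have h1 : ((σ ^ 2) ^ k) i = i := by
        rw [← pow_mul, mul_comm, pow_mul]
        exact perm_pow_apply_of_fixed _ hfix 2
      have h2'' : ((σ ^ 2) ^ 167) i = i := by
        rw [← pow_mul, show 2 * 167 = 334 from rfl, hσ, Equiv.Perm.one_apply]
      exact h2' i (perm_fixed_of_pow_coprime (σ ^ 2) hcop (by norm_num) h1 h2'')
  exact ⟨key π hπ hr hπ2, key κ hκ hc hκ2⟩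

end main

end Summit.Ventures.DiscreteObjects.Hadamard
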